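import Literature.AlgebraicGeometry.ShimuraVarieties.KudlaRapoport2013.Sec3ComplexUniformization
import Literature.NumberTheory.QuadraticForms.LandherrHermitianDiagonalForms
import HarnessLib

/-!
# Kudla–Rapoport II §3: `ν(G(ℝ))` (§3.1) and «`h̃(x̃,x̃) = T > 0 ⇒ m ≤ n − r`» (§3.3) HOLD (discharges of ★ `KR2013_3_1_nuRealRange`, ★ `KR2013_3_6_pre`)

Topic `AlgebraicGeometry/ShimuraVarieties/KudlaRapoport2013`; namespace
`Literature.AlgebraicGeometry.ShimuraVarieties.KudlaRapoport2013.Sec3ComplexUniformization` (the namespace of the row, so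
that the discharge is literally `theorem KR2013_3_1_nuRealRange_holds : KR2013_3_1_nuRealRange`).  THEOREMS ONLY (no
definition, no named fact, no instance, no notation, no `sorry`).  Sibling of the squad-TKR §3 carpet
★ `Sec3ComplexUniformization.lean` (seat plan «GO 500», squad TKR, deal TKR-plan (g2) 2026-09-02 (δ), ruling R-14: a
discharge that pulls a new import cone — here ★ `Literature.NumberTheory.QuadraticForms.LandherrHermitianDiagonalForms`,
Sylvester's inequality `Landherr.card_pos_le_of_congr` — lives in a `…Holds` sibling, not in the statement file, so that
the carpet's importers do not inherit the `QuadraticForms` cone).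

WHAT IS PROVED.  ★ `KR2013_3_1_nuRealRange` ([KudlaRapoport2013] §3.1, the display on arXiv v2 p. 15: «`ν(G(ℝ)) = ℝ^×` for
signature `(r, r)`, and `= ℝ^×_+` for signature `(n−r, r)` with `r ≠ n−r`», typed on the Sylvester normal form
`signDiag n r = diag(1^{n−r}, (−1)^r)`): for `1 ≤ n`, `r ≤ n`, the set
`S = {c ∈ ℝ | ∃ g ∈ GL_n(ℂ), gᴴ · signDiag n r · g = c · signDiag n r}` equals `{c ≠ 0}` if `r = n − r` and `(0, ∞)` otherwise.

PROOF READ.  (1) `c > 0` lies in `S` via `g = √c · 1`.  (2) `0 ∉ S`: `g` and `gᴴ` are invertible, so `gᴴ D g = 0` forces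
`D = signDiag n r = 0`, but `D₀₀ = ±1` (`n ≥ 1`).  (3) `c < 0` in `S` forces `r = n − r`: with `D = diag d` and
`c · D = diag (c · d)`, Sylvester's inequality ★ `Landherr.card_pos_le_of_congr` applied to `gᴴ (diag d) g = diag (c d)` gives
`#{i | c dᵢ > 0} = r ≤ n − r = #{i | dᵢ > 0}`, and applied to the inverse congruence `(g⁻¹)ᴴ (diag (c d)) g⁻¹ = diag d` gives
`n − r ≤ r`.  (4) If `r = n − r` (`n = 2r`) and `c < 0`, the permutation matrix `P_σ` of `σ = (· + r)` on `Fin n`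
(`Equiv.addRight r`) satisfies `P_σᴴ (diag d) P_σ = diag (d ∘ σ) = −diag d`, and `g = √(−c) · P_σ` realises `c`.
Helpers (all `private`, [folklore]): `signDiag_eq` (`rfl`), `card_pos_signDiag` (positive index `n − r`, via Mathlib
`Fin.card_filter_val_lt`), `card_pos_smul_signDiag` (positive index `r` of `c · d`, `c < 0`), `perm_congr_diagonal`,
`coe_mkOfDetNeZero` (`rfl`).
HC_CM is proved only modulo the 7 printed citations until rung 0 closes.

## ED. 2 (2026-09-02; deal TKR-plan (g2) (ε)) — discharge of ★ `KR2013_3_6_pre`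

Append-only: ED. 1's `KR2013_3_1_nuRealRange_holds` and its five helpers are byte-identical; no new import.  WHAT IS PROVED.
★ `KR2013_3_6_pre` ([KudlaRapoport2013] §3.3, the sentence before Corollary 3.6, arXiv v2 p. 18: «if `x̃ ∈ (L̃ ⊗ ℝ)^m` with
`h̃(x̃, x̃) = T > 0`, then `m ≤ n − r`», typed in coordinates): for `Jc` congruent to `signDiag n r` (`Tᴴ Jc T = signDiag n r`,
`T ∈ GL_n(ℂ)`), `a > 0` and `x₁, …, x_m ∈ ℂⁿ` whose Gram matrix `(krFormC Jc xᵢ xⱼ / a)` is positive definite, `m ≤ n − r`.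
PROOF READ (same Sylvester architecture as ED. 1, no index lemma needed beyond the count `card_pos_signDiag`).  Suppose
`m > n − r = #P`, `P = {i | dᵢ = 1}` the positive block of `d = (1^{n−r}, (−1)^r)`.  The linear map
`c ↦ (T⁻¹ · X c)|_P : ℂ^m → ℂ^P` (`X` = the `n × m` matrix with columns `xᵢ`) has a kernel vector `c ≠ 0`
(`LinearMap.ker_ne_bot_of_finrank_lt`); put `v = X c = Σ cᵢ xᵢ`, `u = T⁻¹ v`.  Then `Re (vᴴ Jc v) = Re (uᴴ (Tᴴ Jc T) u) = Σ Re dᵢ |uᵢ|²`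
(★ `Landherr.realQ`, `re_star_dotProduct_diagonal_mulVec`) is `≤ 0` because `u|_P = 0`, and `> 0` because the TRANSPOSE of the
Gram matrix is `a⁻¹ · Xᴴ Jc X` (`krFormC` conjugates its SECOND argument: `krFormC Jc u w = wᴴ Jc u`), positive definite with
the Gram matrix (Mathlib `Matrix.PosDef.transpose`), and `a⁻¹ > 0` scales real parts (`re_pos_of_posDef_smul_inv`) — contradiction.
New `private` [folklore] helpers: `krFormC_eq_dotProduct` (`rfl`), `gram_transpose_eq`, `star_mulVec_dotProduct_mulVec`
(change of variables `(T u)ᴴ J (T u) = uᴴ (Tᴴ J T) u`), `re_pos_of_posDef_smul_inv`.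

## References
* [KudlaRapoport2013] S. Kudla, M. Rapoport, *Special cycles on unitary Shimura varieties II: global theory*,
  J. reine angew. Math. 697 (2014) 91–157; arXiv:0912.3758v2, §3.1 p. 15, §3.3 p. 18.
* [Landherr1936HermitianForms] W. Landherr, *Äquivalenz Hermitescher Formen über einem beliebigen algebraischen
  Zahlkörper*, Abh. Math. Sem. Hamburg 11 (1936) 245–248 (the inertia inequality, ★ `LandherrHermitianDiagonalForms`).
-/

set_option autoImplicit false

noncomputable section

open Matrix
open scoped ComplexOrder

namespace Literature.AlgebraicGeometry.ShimuraVarieties.KudlaRapoport2013.Sec3ComplexUniformization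

open Literature.NumberTheory.QuadraticForms.Landherr (card_pos_le_of_congr)

/-- `signDiag n r` is the diagonal matrix of the vector `(1^{n−r}, (−1)^r)`. [folklore] -/
private theorem signDiag_eq (n r : ℕ) :
    signDiag n r = Matrix.diagonal (fun i : Fin n => if (i : ℕ) < n - r then (1 : ℂ) else -1) := rfl

/-- The positive index of `signDiag n r` is `n − r`. [folklore] -/
private theorem card_pos_signDiag (n r : ℕ) :
    (Finset.univ.filter fun i : Fin n =>
      0 < ((fun i : Fin n => if (i : ℕ) < n - r then (1 : ℂ) else -1) i).re).card = n - r := by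
  have : (Finset.univ.filter fun i : Fin n =>
        0 < ((fun i : Fin n => if (i : ℕ) < n - r then (1 : ℂ) else -1) i).re)
      = Finset.univ.filter fun i : Fin n => (i : ℕ) < n - r := by
    refine Finset.filter_congr fun i _ => ?_
    dsimp only
    split_ifs with h <;> simp [h]
  rw [this, Fin.card_filter_val_lt, min_eq_right (Nat.sub_le n r)]

/-- For `c < 0` the positive index of `c · signDiag n r` is `r` (`r ≤ n`). [folklore] -/
private theorem card_pos_smul_signDiag {n r : ℕ} (hr : r ≤ n) {c : ℝ} (hc : c < 0) :
    (Finset.univ.filter fun i : Fin n =>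
      0 < (((c : ℂ) • fun i : Fin n => if (i : ℕ) < n - r then (1 : ℂ) else -1) i).re).card = r := by
  have : (Finset.univ.filter fun i : Fin n =>
        0 < (((c : ℂ) • fun i : Fin n => if (i : ℕ) < n - r then (1 : ℂ) else -1) i).re)
      = Finset.univ.filter fun i : Fin n => ¬ ((i : ℕ) < n - r) := by
    refine Finset.filter_congr fun i _ => ?_
    simp only [Pi.smul_apply, smul_eq_mul]
    split_ifs with h
    · simp [h, lt_asymm hc]
    · simp [h, hc]
  rw [this]
  have hsum := Finset.card_filter_add_card_filter_not
    (s := (Finset.univ : Finset (Fin n))) (fun i : Fin n => (i : ℕ) < n - r)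
  rw [Fin.card_filter_val_lt, min_eq_right (Nat.sub_le n r), Finset.card_univ, Fintype.card_fin] at hsum
  omega

/-- `((1).submatrix refl σ)ᴴ · diag d · (1).submatrix refl σ = diag (d ∘ σ)` (permutation congruence). [folklore] -/
private theorem perm_congr_diagonal {n : ℕ} (σ : Equiv.Perm (Fin n)) (d : Fin n → ℂ) :
    ((1 : Matrix (Fin n) (Fin n) ℂ).submatrix (Equiv.refl (Fin n)) σ)ᴴ * Matrix.diagonal d
        * (1 : Matrix (Fin n) (Fin n) ℂ).submatrix (Equiv.refl (Fin n)) σ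
      = Matrix.diagonal (d ∘ σ) := by
  rw [Matrix.mul_assoc, Matrix.mul_submatrix_one, Matrix.conjTranspose_submatrix, Matrix.conjTranspose_one,
    Matrix.one_submatrix_mul, Matrix.submatrix_submatrix]
  simp only [Equiv.refl_symm, Equiv.coe_refl, Function.comp_id, Function.id_comp]
  exact Matrix.submatrix_diagonal_equiv d σ

/-- The matrix underlying `GeneralLinearGroup.mkOfDetNeZero A h` is `A`. [folklore] -/
private theorem coe_mkOfDetNeZero {n : ℕ} (A : Matrix (Fin n) (Fin n) ℂ) (h : A.det ≠ 0) :
    ((Matrix.GeneralLinearGroup.mkOfDetNeZero A h : GL (Fin n) ℂ) : Matrix (Fin n) (Fin n) ℂ) = A := rfl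

/-- **[KR2013 §3.1, p. 15] PROVED** — discharge of ★ `KR2013_3_1_nuRealRange`: the real multipliers of
`signDiag n r` under `GL_n(ℂ)`-congruence are `ℝ^×` when `r = n − r` and `ℝ^×_{>0}` otherwise.  Positive `c`:
`g = √c · 1`; `c = 0` is impossible (`g` invertible, `signDiag n r ≠ 0` as `n ≥ 1`); negative `c` forces
`r = n − r` by Sylvester's inequality ★ `Landherr.card_pos_le_of_congr` applied to `g` and to `g⁻¹`
(positive index `n − r` of `signDiag n r` vs. `r` of `c · signDiag n r`), and for `r = n − r` the permutation
matrix of `i ↦ i + r (mod n)` scaled by `√(−c)` realises `c`. [cite: KudlaRapoport2013, §3.1 (arXiv v2 p. 15)] -/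
theorem KR2013_3_1_nuRealRange_holds : KR2013_3_1_nuRealRange := by
  intro n r hn hr S
  -- (1) positive multipliers: `g = √c · 1`
  have pos_mem : ∀ c : ℝ, 0 < c → c ∈ S := by
    intro c hc
    have ha : ((Real.sqrt c : ℝ) : ℂ) ≠ 0 := by exact_mod_cast (Real.sqrt_pos.mpr hc).ne'
    refine ⟨Matrix.GeneralLinearGroup.mkOfDetNeZero
      (((Real.sqrt c : ℝ) : ℂ) • (1 : Matrix (Fin n) (Fin n) ℂ)) ?_, ?_⟩
    · rw [Matrix.det_smul, Matrix.det_one, mul_one]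
      exact pow_ne_zero _ ha
    · rw [coe_mkOfDetNeZero, Matrix.conjTranspose_smul, Matrix.conjTranspose_one, Matrix.smul_mul,
        Matrix.one_mul, Matrix.mul_smul, Matrix.mul_one, smul_smul]
      congr 1
      rw [Complex.star_def, Complex.conj_ofReal, ← Complex.ofReal_mul, Real.mul_self_sqrt hc.le]
  -- (2) `0 ∉ S`
  have zero_nmem : (0 : ℝ) ∉ S := by
    rintro ⟨g, hg⟩
    rw [Complex.ofReal_zero, zero_smul] at hg
    have hD : signDiag n r = 0 := by
      have h := congrArg (fun M => ((g⁻¹ : GL (Fin n) ℂ) : Matrix (Fin n) (Fin n) ℂ)ᴴ * M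
        * ((g⁻¹ : GL (Fin n) ℂ) : Matrix (Fin n) (Fin n) ℂ)) hg
      simp only [Matrix.mul_zero, Matrix.zero_mul] at h
      rw [← h, ← Matrix.mul_assoc, ← Matrix.mul_assoc, ← Matrix.conjTranspose_mul, Units.mul_inv,
        Matrix.conjTranspose_one, Matrix.one_mul, Matrix.mul_assoc, Units.mul_inv, Matrix.mul_one]
    have h00 := congrFun (congrFun hD ⟨0, hn⟩) ⟨0, hn⟩
    rw [signDiag, Matrix.diagonal_apply_eq, Matrix.zero_apply] at h00
    split_ifs at h00 <;> norm_num at h00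
  -- (3) a negative multiplier forces `r = n − r` (Sylvester, both directions)
  have neg_imp : ∀ c : ℝ, c < 0 → c ∈ S → r = n - r := by
    rintro c hc ⟨g, hg⟩
    rw [signDiag_eq, ← Matrix.diagonal_smul] at hg
    have h1 := card_pos_le_of_congr hg
    rw [card_pos_smul_signDiag hr hc, card_pos_signDiag] at h1
    have hg' : ((g⁻¹ : GL (Fin n) ℂ) : Matrix (Fin n) (Fin n) ℂ)ᴴ
        * Matrix.diagonal ((c : ℂ) • fun i : Fin n => if (i : ℕ) < n - r then (1 : ℂ) else -1)
        * ((g⁻¹ : GL (Fin n) ℂ) : Matrix (Fin n) (Fin n) ℂ)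
        = Matrix.diagonal (fun i : Fin n => if (i : ℕ) < n - r then (1 : ℂ) else -1) := by
      rw [← hg, ← Matrix.mul_assoc, ← Matrix.mul_assoc, ← Matrix.conjTranspose_mul, Units.mul_inv,
        Matrix.conjTranspose_one, Matrix.one_mul, Matrix.mul_assoc, Units.mul_inv, Matrix.mul_one]
    have h2 := card_pos_le_of_congr hg'
    rw [card_pos_smul_signDiag hr hc, card_pos_signDiag] at h2
    omega
  -- (4) for `r = n − r`, every negative `c` is a multiplier: block-swap permutation scaled by `√(−c)`
  have neg_mem : r = n - r → ∀ c : ℝ, c < 0 → c ∈ S := by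
    intro hrr c hc
    have hn2 : n = r + r := by omega
    haveI : NeZero n := ⟨by omega⟩
    set σ : Equiv.Perm (Fin n) := Equiv.addRight (⟨r, by omega⟩ : Fin n) with hσ
    have hσd : (fun i : Fin n => if (i : ℕ) < n - r then (1 : ℂ) else -1) ∘ σ
        = -fun i : Fin n => if (i : ℕ) < n - r then (1 : ℂ) else -1 := by
      funext i
      simp only [Function.comp_apply, Pi.neg_apply, hσ, Equiv.coe_addRight, Fin.val_add]
      have key : ((i : ℕ) + r) % n < n - r ↔ ¬ ((i : ℕ) < n - r) := by
        by_cases hi : (i : ℕ) < r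
        · rw [Nat.mod_eq_of_lt (by omega)]
          omega
        · rw [Nat.mod_eq_sub_mod (by omega), Nat.mod_eq_of_lt (by omega)]
          omega
      by_cases h2 : (i : ℕ) < n - r
      · have h1 : ¬ (((i : ℕ) + r) % n < n - r) := fun h => key.mp h h2
        rw [if_neg h1, if_pos h2]
      · have h1 : ((i : ℕ) + r) % n < n - r := key.mpr h2
        rw [if_pos h1, if_neg h2, neg_neg]
    set a : ℂ := ((Real.sqrt (-c) : ℝ) : ℂ) with ha_def
    have ha : a ≠ 0 := by
      rw [ha_def]; exact_mod_cast (Real.sqrt_pos.mpr (neg_pos.mpr hc)).ne'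
    have haa : star a * a = -(c : ℂ) := by
      rw [ha_def, Complex.star_def, Complex.conj_ofReal, ← Complex.ofReal_mul, Real.mul_self_sqrt (neg_pos.mpr hc).le,
        Complex.ofReal_neg]
    set P : Matrix (Fin n) (Fin n) ℂ := (1 : Matrix (Fin n) (Fin n) ℂ).submatrix (Equiv.refl (Fin n)) σ with hP
    refine ⟨Matrix.GeneralLinearGroup.mkOfDetNeZero (a • P) ?_, ?_⟩
    · rw [Matrix.det_smul, hP]
      refine mul_ne_zero (pow_ne_zero _ ha) ?_
      rw [show ((1 : Matrix (Fin n) (Fin n) ℂ).submatrix (Equiv.refl (Fin n)) σ)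
          = (1 : Matrix (Fin n) (Fin n) ℂ).submatrix id σ from rfl, Matrix.det_permute', Matrix.det_one, mul_one]
      exact_mod_cast (Equiv.Perm.sign σ).ne_zero
    · rw [coe_mkOfDetNeZero, Matrix.conjTranspose_smul, Matrix.smul_mul, Matrix.mul_smul, Matrix.smul_mul,
        smul_smul, signDiag_eq, hP, perm_congr_diagonal σ, hσd, mul_comm a (star a), haa,
        ← Matrix.diagonal_smul, ← Matrix.diagonal_smul]
      congr 1
      funext i
      simp only [Pi.smul_apply, Pi.neg_apply, smul_eq_mul]
      split_ifs <;> ring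
  refine ⟨fun hrr => ?_, fun hrr => ?_⟩
  · ext c
    refine ⟨fun hcS => ?_, fun (hc0 : c ≠ 0) => ?_⟩
    · rintro rfl
      exact zero_nmem hcS
    · rcases lt_or_gt_of_ne hc0 with hlt | hgt
      · exact neg_mem hrr c hlt
      · exact pos_mem c hgt
  · ext c
    refine ⟨fun hcS => ?_, fun (hc0 : 0 < c) => pos_mem c hc0⟩
    rcases lt_trichotomy c 0 with hlt | rfl | hgt
    · exact absurd (neg_imp c hlt hcS) hrr
    · exact absurd hcS zero_nmem
    · exact hgt

/-! ## ED. 2 — discharge of ★ `KR2013_3_6_pre` (§3.3, arXiv v2 p. 18) -/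

section PreCorollary36

open Literature.NumberTheory.QuadraticForms.Landherr (realQ re_star_dotProduct_diagonal_mulVec)

/-- `krFormC Jc u w = star w ⬝ᵥ (Jc *ᵥ u)` (the second slot is conjugated). [folklore] -/
private theorem krFormC_eq_dotProduct {n : ℕ} (Jc : Matrix (Fin n) (Fin n) ℂ) (u w : Fin n → ℂ) :
    krFormC Jc u w = star w ⬝ᵥ (Jc *ᵥ u) := rfl

/-- The Gram matrix of `x₁, …, x_m` for `krFormC Jc`, transposed, is `Xᴴ · Jc · X` for the matrix `X` with
columns `x_i`. [folklore] -/
private theorem gram_transpose_eq {n m : ℕ} (Jc : Matrix (Fin n) (Fin n) ℂ) (x : Fin m → (Fin n → ℂ)) :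
    (Matrix.of fun i j => krFormC Jc (x i) (x j))ᵀ
      = (Matrix.of fun p i => x i p)ᴴ * (Jc * Matrix.of fun p i => x i p) := by
  ext i j
  simp only [Matrix.transpose_apply, Matrix.of_apply, krFormC_eq_dotProduct, dotProduct, Matrix.mulVec,
    Matrix.mul_apply, Matrix.conjTranspose_apply, Pi.star_apply]

/-- Change of variables in a sesquilinear form: `(T u)ᴴ · J · (T u) = uᴴ · (Tᴴ J T) · u`. [folklore] -/
private theorem star_mulVec_dotProduct_mulVec {n k : ℕ} (T : Matrix (Fin n) (Fin k) ℂ) (J : Matrix (Fin n) (Fin n) ℂ)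
    (u : Fin k → ℂ) : star (T *ᵥ u) ⬝ᵥ (J *ᵥ (T *ᵥ u)) = star u ⬝ᵥ ((Tᴴ * J * T) *ᵥ u) := by
  rw [Matrix.star_mulVec, ← Matrix.dotProduct_mulVec, Matrix.mulVec_mulVec, Matrix.mulVec_mulVec]

/-- Scaling the Gram matrix by `a⁻¹`, `a > 0`, and transposing keeps the real parts of its values positive:
if `(of k · a⁻¹)` is positive definite then `Re (c̄ ⬝ (of k)ᵀ c) > 0` for `c ≠ 0`. [folklore] -/
private theorem re_pos_of_posDef_smul_inv {m : ℕ} (k : Fin m → Fin m → ℂ) {a : ℝ} (ha : 0 < a)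
    (hG : (Matrix.of fun i j => k i j * ((a : ℂ))⁻¹).PosDef) {c : Fin m → ℂ} (hc : c ≠ 0) :
    0 < (star c ⬝ᵥ ((Matrix.of fun i j => k i j)ᵀ *ᵥ c)).re := by
  have hT := hG.transpose.dotProduct_mulVec_pos hc
  have hre := (Complex.lt_def.mp hT).1
  rw [Complex.zero_re] at hre
  have hmat : (Matrix.of fun i j => k i j * ((a : ℂ))⁻¹)ᵀ = ((a⁻¹ : ℝ) : ℂ) • (Matrix.of fun i j => k i j)ᵀ := by
    ext i j
    simp only [Matrix.transpose_apply, Matrix.of_apply, Matrix.smul_apply, smul_eq_mul, Complex.ofReal_inv]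
    ring
  rw [hmat, Matrix.smul_mulVec, dotProduct_smul, smul_eq_mul, Complex.re_ofReal_mul] at hre
  exact (mul_pos_iff_of_pos_left (inv_pos.mpr ha)).mp hre

/-- **[KR2013 §3.3, the sentence before Cor. 3.6, arXiv v2 p. 18] PROVED** — discharge of ★ `KR2013_3_6_pre`: if `Jc` is
congruent to `signDiag n r` and `x₁, …, x_m ∈ ℂⁿ` have positive-definite Gram matrix `(h̃(x_i, x_j)/a)` (`a > 0`), then
`m ≤ n − r`.  Sylvester architecture: were `m > n − r`, the linear map `c ↦ (T⁻¹ Σ cᵢ xᵢ)|_{positive block}`,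
`ℂ^m → ℂ^{n−r}`, has a kernel vector `c ≠ 0`; for `v = Σ cᵢ xᵢ`, `u = T⁻¹ v` the value `Re h̃(v, v) = Σ dᵢ |uᵢ|²` is
`≤ 0` (only the `−1` block survives) and `> 0` (positive definiteness at `c`). [cite: KudlaRapoport2013, §3.3 (arXiv v2 p. 18)] -/
theorem KR2013_3_6_pre_holds : KR2013_3_6_pre := by
  intro n r m Jc hJ a ha x hG
  classical
  obtain ⟨T, hT⟩ := hJ
  by_contra hlt
  rw [not_le] at hlt
  -- notation
  set d : Fin n → ℂ := fun i => if (i : ℕ) < n - r then (1 : ℂ) else -1 with hd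
  set P : Finset (Fin n) := Finset.univ.filter fun i => 0 < (d i).re with hP
  have memP : ∀ i, i ∈ P ↔ 0 < (d i).re := fun i => by rw [hP]; simp
  have hcardP : P.card = n - r := by rw [hP]; exact card_pos_signDiag n r
  set X : Matrix (Fin n) (Fin m) ℂ := Matrix.of fun p i => x i p with hX
  set Ti : Matrix (Fin n) (Fin n) ℂ := ((T⁻¹ : GL (Fin n) ℂ) : Matrix (Fin n) (Fin n) ℂ) with hTi
  -- the linear map `c ↦ (T⁻¹ X c)|_P`
  let φ : (Fin m → ℂ) →ₗ[ℂ] ({i // i ∈ P} → ℂ) :=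
    (LinearMap.funLeft ℂ ℂ (Subtype.val : {i // i ∈ P} → Fin n)) ∘ₗ Ti.mulVecLin ∘ₗ X.mulVecLin
  have hdim : Module.finrank ℂ ({i // i ∈ P} → ℂ) < Module.finrank ℂ (Fin m → ℂ) := by
    rw [Module.finrank_fintype_fun_eq_card, Module.finrank_fintype_fun_eq_card, Fintype.card_coe,
      Fintype.card_fin, hcardP]
    exact hlt
  obtain ⟨c, hc, hc0⟩ := (Submodule.ne_bot_iff _).mp (LinearMap.ker_ne_bot_of_finrank_lt (f := φ) hdim)
  rw [LinearMap.mem_ker] at hc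
  set v : Fin n → ℂ := X *ᵥ c with hv
  set u : Fin n → ℂ := Ti *ᵥ v with hu
  have huP : ∀ i, i ∈ P → u i = 0 := by
    intro i hi
    have := congrFun hc ⟨i, hi⟩
    simpa [φ, LinearMap.funLeft_apply, hu, hv, Matrix.mulVec_mulVec] using this
  -- (A) the diagonal form is ≤ 0 on `u`
  have hle : realQ d u ≤ 0 := by
    refine Finset.sum_nonpos fun i _ => ?_
    by_cases hi : i ∈ P
    · rw [huP i hi]; simp
    · have hdi : (d i).re ≤ 0 := not_lt.mp fun h => hi ((memP i).mpr h)
      exact mul_nonpos_of_nonpos_of_nonneg hdi (by positivity)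
  -- (B) … and > 0, being `Re h̃(v, v)` with `v = Σ cᵢ xᵢ`, `c ≠ 0`
  have hTu : (T : Matrix (Fin n) (Fin n) ℂ) *ᵥ u = v := by
    rw [hu, hTi, Matrix.mulVec_mulVec, Units.mul_inv, Matrix.one_mulVec]
  have hform : star v ⬝ᵥ (Jc *ᵥ v) = star u ⬝ᵥ (Matrix.diagonal d *ᵥ u) := by
    rw [← signDiag_eq, ← hT, ← hTu]
    exact star_mulVec_dotProduct_mulVec _ _ _
  have hgt : 0 < realQ d u := by
    rw [← re_star_dotProduct_diagonal_mulVec, ← hform]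
    have h1 := re_pos_of_posDef_smul_inv (fun i j => krFormC Jc (x i) (x j)) ha hG hc0
    rw [gram_transpose_eq, ← hX, ← Matrix.mul_assoc, ← star_mulVec_dotProduct_mulVec, ← hv] at h1
    exact h1
  linarith

end PreCorollary36

end Literature.AlgebraicGeometry.ShimuraVarieties.KudlaRapoport2013.Sec3ComplexUniformization

end
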